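import Summits.Ventures.YMGap.RobustBall.FreeEnergyLawDerivative
import Summits.Ventures.YMGap.RobustBall.FreeEnergyLawRatio
import Summits.Ventures.YMGap.RobustBall.FreeEnergyWeakCouplingFloor
import Literature.RepresentationTheory.CompactGroups.UnitaryTrick
import Summits.Ventures.YMGap.Thresholds.PressureDerivative
import Summits.Ventures.YMGap.Thresholds.PressureSecondDerivative
import Summits.Ventures.YMGap.Thresholds.PressureDerivativeSUN
import Summits.Ventures.YMGap.RobustBall.BoundaryDecaySummableSU2
import HarnessLib

/-!
# Venture statement — YMGap (cell `pub-ymgap`) — CONJUNCT BODIES T55 (strong-coupling free-energy laws), T56 (pressure C¹/C² at strong coupling), T57 (boundary rate uniformly on the tier-2 ball) (V22, block 1 of 4)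

STATUS: FILED by p2 g12 as contingent filer under lead R299 (bus 2026-08-23T22:22:12Z) on the lead's V22 BOOKING line, quoted verbatim:
«2026-08-23T23:50:48Z lead (g8) → ★ V22 BOOKING (R294/R299/R301; lead g8) → p2 (g12) [inject verbatim via mkcandidates.sh], referee (g30), p3 (g7),
writer (g12), rb-theory (g16) cc owners: `StatementConjunctsV22.lean` = block A dff4d65aabaff373 (372 l) (T55a–d·T55 rb-p2 FreeEnergyLaw; T56a–e·T56
ds-1 Pressure-A; T57a,b·T57 ds-3 part D) · `…V22B.lean` = block B 609b24d462b1cfbc (382 l) (T58a,b·T58; T59a,b·T59; T46a–c·T46; T60a,b·T60) ·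
`…V22C.lean` = block C e081844ac208ac1b (342 l) (T62a–e·T62 ds-3 part B; T63 ds-3 part H; T65a,b·T65 ds-4 CentreTube) · `…V22D.lean` = block D
a5d811943bcc1fdb (155 l; T61a–d·T61 ds-1 Pressure-B) «4 of 4»; numbered base A 6af97ec141cbb745 / B e6e71cdd58a392a0 / C bdd095e9b6ac86ce / D
701ed23113043693 (numbered monolith 61108ff1cf2b97b8; byte-compare 35/35); map v1 127e243484fe3a02 + addenda 2254c71f1c2725b3; FINAL SET = p2 l.4946
(re-probe 23:44–23:47Z: T65/T61 GREEN, T64 rc 75). Every conjunct restates BY NAME a theorem already ACCEPTED in the tree (statement-index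
bookkeeping; finite lattice, strong/intermediate coupling; nothing continuum / OS / infinite-volume-limit-as-physics / mass gap / Clay). Filer p2 g12
per R299 (p3 g7 does NOT claim; fallback only if no p2 INTENT/SUBMITTED by 00:30Z): `--kind definition`, ≤ 400 l/block, dry-runs, 00:10Z INTENT check,
file A → B → C → D, ONE «SUBMITTED» line with pids + filed sha16s + consolidating decl names per block; referee g30 legs on FILED bytes; lead books on
ACCEPT + commit. V23 = T64a–e·T64 (rb-p1, unbuilt parent at the re-probe; numbered-PENDING 9e47a244954cc2f4), T65c (ds-4), T66a–e (ds-3), T67a–d +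
T68a (rb-p2 098236ae25992b7a); no T68b. RECORD: v1.11 `YMGapStatementV1_11` p368908 7bed0099cf4c OF RECORD (l.4883); v1.12 := v1.11 ∧ V22 ∧ V22B ∧
V22C ∧ V22D by a later seat after V22* are built (p3 l.4789 (3), tools-p3/mkindex_next.py).».
First of four V22 block files (the second,
`StatementConjunctsV22B.lean`, carries T58, T59, T46, T60; the third, `StatementConjunctsV22C.lean`, T62, T63, T65; the fourth, `StatementConjunctsV22D.lean`, T61).  Texts: T55 = seat rb-p2 g7's four texts (`HOME/rb/lean-rb-p2/T-texts-rbp2g7.lean` e458e8240009a1cc) VERBATIM;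
T56 = seat ds-1 g9's block A (`HOME/ds/ds1g9/lean/V1X-CONJUNCTS-ds1g9-A.lean` f3049cfe4424924c) VERBATIM; T57 = seat ds-3 g12's part D
(`HOME/ds/ds3/lean/g12/texts/V1XConjunctsDS3g12D.lean` e73730e0ac1422ed) VERBATIM.  Only decl names change (`T_X` → `T5kx_X`, map of record
`HOME/p2/v22-prestage/RENAMES-PROPOSAL.txt` 127e243484fe3a02, lead R294); the consolidating conjunctions `T55_…`, `T56_…`, `T57_…` are the pre-stage defaults
(one per owner file).  Built mechanically by `HOME/p2/v22-prestage/mkmono.py` from the owner files; byte-compare `bytecmp.py --map` = VERBATIM-modulo-map.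
Index entry `YMGapStatementV1_12 := YMGapStatementV1_11 ∧ T55 ∧ … ` only after both block files land and build.

HONEST FRAMING. WHAT THIS IS: bodies `Tk_… : Prop` + witnesses `Tk_…_holds`, kernel-checked with NO hypothesis, closing by TREE constants only. STRONG-COUPLING
LATTICE statements about `SU(N)` lattice Yang–Mills with the Wilson action / members of the typed perturbation balls: thermodynamic-limit free energy and pressure
with explicit two-sided strong-coupling laws and `C¹`/`C²` regularity on explicit windows (T55, T56), and the one-state boundary rate uniformly on the summable
tier-2 ball (T57).  Every window, radius or constant is where a BOUND closes, not a transition.  WHAT THIS IS NOT: no analyticity, no sharp constants, nothing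
about the crossover, scaling, a continuum limit, confinement in the continuum, or the Yang–Mills Millennium problem.
-/

noncomputable section

namespace Summit.Ventures.YMGap

/-! ### OWNER FILE `rb/lean-rb-p2/T-texts-rbp2g7.lean` (sha16 e458e8240009a1cc) — section `V22_rbp2_FreeEnergyLaw` -/
section V22_rbp2_FreeEnergyLaw

open Summit.Ventures.YMGap.RobustBall

/-!
# T-text candidates of seat rb-p2 (g7) for p3 — THE STRONG-COUPLING FREE-ENERGY LAW (not a proposal; imports the landed files
`RobustBall/FreeEnergyLaw{,Derivative,Ratio}.lean`, `RobustBall/FreeEnergyWeakCouplingFloor.lean`; mono-checked rc 0 against the scratch monolith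
`MonoG7-T.scratch.lean`).
-/


open MeasureTheory Filter Topology Finset
open Literature.MathematicalPhysics.QuantumLattice
open Literature.MathematicalPhysics.QuantumFieldTheory hiding ZdEdge


/-! ### T-text candidates (p3) — bodies are the TYPES of the named theorems with hypotheses as binders -/


open Summit.Ventures.YMGap.RobustBall.FreeEnergyLaw

/-- ★★★ **T55a_SU2FreeEnergyStrongCouplingLawDim4** (track Y2, seat rb-p2 g7; `RobustBall/FreeEnergyLaw.lean`): THE STRONG-COUPLING
FREE-ENERGY LAW for `SU(2)` lattice Yang–Mills on `ℤ⁴`.  (i) For EVERY `β_W ≥ 0` the free energy density per site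
`f = lim_L |Λ_L|⁻¹ log Z_{Λ_L}` of the torus Wilson states at tree coupling `β_W/2` EXISTS as the full thermodynamic limit and obeys
`(3/4)β_W² e^{−54β_W} ≤ f + 6β_W ≤ (3/4)β_W² e^{72β_W}` (`(3/4)β_W²` = the leading strong-coupling term, six plaquettes per site times
`β_W²/8`; `f + 6β_W = lim |Λ|⁻¹ log ∫ e^{(β_W/2) Σ_p Re tr U_p}`); (ii) hence `(f(β_W/2) + 6β_W)/((3/4)β_W²) → 1` as `β_W → 0⁺`:
`∀ ε > 0 ∃ β₀ > 0 ∀ 0 < β_W ≤ β₀, |ratio − 1| ≤ ε`; (iii) every `N ≥ 3`, `d = 4`, tree coupling `β ≥ 0`: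
`(3/2)β² e^{−54Nβ} ≤ f(β) + 6Nβ ≤ (3/2)β² e^{72Nβ}`.  HONEST LABEL: lattice, Wilson action; the leading term is exact, the
`e^{∓O(β)}` window is a one-link artefact valid at every coupling (vacuous-but-true at large coupling); nothing about the
crossover, the continuum, spectra or Clay. -/
def T55a_SU2FreeEnergyStrongCouplingLawDim4 : Prop :=
  (∀ βW : ℝ, 0 ≤ βW → ∃ f : ℝ, HasFreeEnergyDensity 4 (fundamentalRep (Fin 2)) (βW / 2) f ∧
      3 / 4 * βW ^ 2 * Real.exp (-(54 * βW)) ≤ f + 6 * βW ∧ f + 6 * βW ≤ 3 / 4 * βW ^ 2 * Real.exp (72 * βW)) ∧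
  (∀ ε : ℝ, 0 < ε → ∃ β₀ : ℝ, 0 < β₀ ∧ ∀ βW : ℝ, 0 < βW → βW ≤ β₀ →
      |(freeEnergyDensity 4 (fundamentalRep (Fin 2)) (βW / 2) + 6 * βW) / (3 / 4 * βW ^ 2) - 1| ≤ ε) ∧
  (∀ N : ℕ, 3 ≤ N → ∀ β : ℝ, 0 ≤ β →
      3 / 2 * β ^ 2 * Real.exp (-(54 * N * β)) ≤ freeEnergyDensity 4 (fundamentalRep (Fin N)) β + 6 * N * β ∧
        freeEnergyDensity 4 (fundamentalRep (Fin N)) β + 6 * N * β ≤ 3 / 2 * β ^ 2 * Real.exp (72 * N * β))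

/-- T55a_SU2FreeEnergyStrongCouplingLawDim4 holds (`su2_exists_hasFreeEnergyDensity_two_sided_dim4`, `su2_freeEnergy_ratio_limit_dim4`,
`suN_freeEnergy_two_sided_dim4`). -/
theorem T55a_SU2FreeEnergyStrongCouplingLawDim4_holds : T55a_SU2FreeEnergyStrongCouplingLawDim4 :=
  ⟨fun _ hβ => su2_exists_hasFreeEnergyDensity_two_sided_dim4 hβ, su2_freeEnergy_ratio_limit_dim4,
    fun _ hN _ hβ => suN_freeEnergy_two_sided_dim4 hN hβ⟩

/-- ★★ **T55b_SUNFreeEnergyStrongCouplingLaw** (every `G ≅ SU(N)`, `N ≥ 2`, every `d ≥ 2`, every `β ≥ 0`;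
`RobustBall/FreeEnergyLaw.lean` `freeEnergyDensity_two_sided`): `#planes·(V₀β²/2)·e^{−2(d−1)(2d+1)Nβ} ≤ f(β) + #planes·N·β ≤
#planes·(V₀β²/2)·e^{8(d−1)²Nβ}`, `#planes = card{(i,j) : i < j}`, `V₀ = charVariance ρ`. -/
def T55b_SUNFreeEnergyStrongCouplingLaw : Prop :=
  ∀ (d N : ℕ), 2 ≤ N → 2 ≤ d → ∀ β : ℝ, 0 ≤ β →
    (Fintype.card {q : Fin d × Fin d // q.1 < q.2} : ℝ) *
          (PlaquetteLowerBound.charVariance (fundamentalRep (Fin N)) * β ^ 2 / 2) *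
          Real.exp (-(2 * ((d : ℝ) - 1) * (2 * (d : ℝ) + 1) * N * β)) ≤
        freeEnergyDensity d (fundamentalRep (Fin N)) β + (Fintype.card {q : Fin d × Fin d // q.1 < q.2} : ℝ) * N * β ∧
      freeEnergyDensity d (fundamentalRep (Fin N)) β + (Fintype.card {q : Fin d × Fin d // q.1 < q.2} : ℝ) * N * β ≤
        (Fintype.card {q : Fin d × Fin d // q.1 < q.2} : ℝ) *
          (PlaquetteLowerBound.charVariance (fundamentalRep (Fin N)) * β ^ 2 / 2) * Real.exp (8 * ((d : ℝ) - 1) ^ 2 * N * β)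

/-- T55b_SUNFreeEnergyStrongCouplingLaw holds (`freeEnergyDensity_two_sided` with `TorusAreaLaw.isSpecialUnitaryModel_fundamentalRep`). -/
theorem T55b_SUNFreeEnergyStrongCouplingLaw_holds : T55b_SUNFreeEnergyStrongCouplingLaw :=
  fun _ N hN hd _ hβ => freeEnergyDensity_two_sided _ (TorusAreaLaw.isSpecialUnitaryModel_fundamentalRep N) hN hd hβ

/-- ★★ **T55c_SU2InternalEnergyLawDim4** (`RobustBall/FreeEnergyLawDerivative.lean`): (i) off a countable set of couplings the free energy
density of `SU(2)` on `ℤ⁴` is differentiable and `3β_W e^{−54β_W} ≤ f'(β_W/2) + 12 ≤ 3β_W e^{72β_W}` wherever it is differentiable at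
`β_W/2 ≥ 0`; (ii) THE TORUS MEAN-PLAQUETTE LAW eventually in the volume: for every `β_W ≥ 0` and `ε > 0`, for all large `L`, every plaquette
of `(ℤ/(L+1)ℤ)⁴` has `(β_W/2) e^{−54β_W} − ε ≤ ⟨Re tr U_{x,ij}⟩_{Λ_{L+1}, β_W/2} ≤ (β_W/2) e^{72β_W} + ε`. -/
def T55c_SU2InternalEnergyLawDim4 : Prop :=
  ({s : ℝ | ¬ DifferentiableAt ℝ (freeEnergyDensity 4 (fundamentalRep (Fin 2))) s}.Countable ∧
    ∀ βW : ℝ, 0 ≤ βW → DifferentiableAt ℝ (freeEnergyDensity 4 (fundamentalRep (Fin 2))) (βW / 2) →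
      3 * βW * Real.exp (-(54 * βW)) ≤ deriv (freeEnergyDensity 4 (fundamentalRep (Fin 2))) (βW / 2) + 12 ∧
        deriv (freeEnergyDensity 4 (fundamentalRep (Fin 2))) (βW / 2) + 12 ≤ 3 * βW * Real.exp (72 * βW)) ∧
  (∀ βW : ℝ, 0 ≤ βW → ∀ ε : ℝ, 0 < ε → ∀ᶠ L : ℕ in atTop, ∀ (x : Site 4 (L + 1)) (i j : Fin 4), i ≠ j →
      βW / 2 * Real.exp (-(54 * βW)) - ε ≤
          wilsonExpectation (L := L + 1) (fundamentalRep (Fin 2)) (βW / 2)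
            (fun U : GaugeConfig 4 (L + 1) (SUN 2) => ((fundamentalRep (Fin 2)) (plaquetteHolonomy U x i j)).trace.re) ∧
        wilsonExpectation (L := L + 1) (fundamentalRep (Fin 2)) (βW / 2)
            (fun U : GaugeConfig 4 (L + 1) (SUN 2) => ((fundamentalRep (Fin 2)) (plaquetteHolonomy U x i j)).trace.re) ≤
          βW / 2 * Real.exp (72 * βW) + ε)

/-- T55c_SU2InternalEnergyLawDim4 holds. -/
theorem T55c_SU2InternalEnergyLawDim4_holds : T55c_SU2InternalEnergyLawDim4 := by
  have hρ := TorusAreaLaw.isSpecialUnitaryModel_fundamentalRep 2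
  refine ⟨⟨Balaban1983to89.Missing.countable_not_differentiableAt_of_convexOn_univ (convexOn_freeEnergyDensity _ hρ.1),
    fun βW hβ hdiff => su2_deriv_freeEnergy_two_sided_dim4 hβ hdiff⟩, fun βW hβ ε hε => ?_⟩
  have h := eventually_torusPlaquette_two_sided (d := 4) (fundamentalRep (Fin 2)) hρ le_rfl (by norm_num)
    (by positivity : (0 : ℝ) ≤ βW / 2) hε
  filter_upwards [h] with L hL x i j hij
  obtain ⟨h1, h2⟩ := hL x i j hij
  rw [HaarSecondMoments.charVariance_su2] at h1 h2
  push_cast at h1 h2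
  have e1 : (1 : ℝ) * (βW / 2) * Real.exp (-(2 * ((4 : ℝ) - 1) * (2 * (4 : ℝ) + 1) * 2 * (βW / 2))) =
      βW / 2 * Real.exp (-(54 * βW)) := by ring_nf
  have e2 : (1 : ℝ) * (βW / 2) * Real.exp (8 * ((4 : ℝ) - 1) ^ 2 * 2 * (βW / 2)) = βW / 2 * Real.exp (72 * βW) := by ring_nf
  rw [e1] at h1
  rw [e2] at h2
  exact ⟨h1, h2⟩

/-- ★★ **T55d_SU2FreeEnergySandwichDim4** (`RobustBall/FreeEnergyLaw.lean` + `RobustBall/FreeEnergyWeakCouplingFloor.lean`): THE FREE ENERGY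
OF `SU(2)` LATTICE YANG–MILLS ON `ℤ⁴` AT EVERY COUPLING, both regimes — with `f = freeEnergyDensity 4 χ₂ (β_W/2)` and the interaction
pressure `g(β_W) = f + 6β_W`: (i) for every `β_W ≥ 0`, `(3/4)β_W² e^{−54β_W} ≤ g(β_W) ≤ min((3/4)β_W² e^{72β_W}, 6β_W)` (strong-coupling law +
the ceiling `f ≤ 0`); (ii) for every `β_W ≥ 2/3`, `g(β_W) ≥ 6β_W − 8 log β_W − (8 + 8 log 3 + 24 log 2)` (the weak-coupling floor: the shape
`#planes·N·β − O(log β)`).  HONEST LABEL: lattice; constants are one-link / link-ball artefacts (true log-coefficient `9/2`); not Chatterjee's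
theorem; nothing continuum / Clay. -/
def T55d_SU2FreeEnergySandwichDim4 : Prop :=
  (∀ βW : ℝ, 0 ≤ βW →
    3 / 4 * βW ^ 2 * Real.exp (-(54 * βW)) ≤ freeEnergyDensity 4 (fundamentalRep (Fin 2)) (βW / 2) + 6 * βW ∧
      freeEnergyDensity 4 (fundamentalRep (Fin 2)) (βW / 2) + 6 * βW ≤ 3 / 4 * βW ^ 2 * Real.exp (72 * βW) ∧
      freeEnergyDensity 4 (fundamentalRep (Fin 2)) (βW / 2) ≤ 0) ∧
  (∀ βW : ℝ, 2 / 3 ≤ βW →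
    -(8 * Real.log βW) - (8 + 8 * Real.log 3 + 24 * Real.log 2) ≤ freeEnergyDensity 4 (fundamentalRep (Fin 2)) (βW / 2))

/-- T55d_SU2FreeEnergySandwichDim4 holds (`su2_freeEnergy_two_sided_dim4`, `freeEnergyDensity_nonpos`, `su2_freeEnergy_ge_weakCoupling_dim4`). -/
theorem T55d_SU2FreeEnergySandwichDim4_holds : T55d_SU2FreeEnergySandwichDim4 := by
  refine ⟨fun βW hβ => ?_, fun βW hβ => (su2_freeEnergy_ge_weakCoupling_dim4 hβ).1⟩
  obtain ⟨h1, h2⟩ := su2_freeEnergy_two_sided_dim4 hβ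
  have hρ := (TorusAreaLaw.isSpecialUnitaryModel_fundamentalRep 2).1
  have hρN : ∀ g : Matrix.specialUnitaryGroup (Fin 2) ℂ, (fundamentalRep (Fin 2) g).trace.re ≤ (2 : ℕ) := fun g =>
    (abs_le.1 (Literature.RepresentationTheory.CompactGroups.CompactGroup.abs_re_trace_le_card (fundamentalRep (Fin 2)) hρ g)).2
  exact ⟨h1, h2, freeEnergyDensity_nonpos (d := 4) _ hρ hρN (by positivity)⟩

end V22_rbp2_FreeEnergyLaw

/-! ### OWNER FILE `ds/ds1g9/lean/V1X-CONJUNCTS-ds1g9-A.lean` (sha16 f3049cfe4424924c) — section `V22_ds1_PressureA` -/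
section V22_ds1_PressureA

/-!
# v1.x conjunct CANDIDATE texts for p3 (ds-1 g9, row type C-PRESS) — BLOCK A (parents IN THE TREE: PressureDerivative 3571d1351893,
# PressureSecondDerivative + PressureDerivativeSUN b68e637a0b6f) — NOT a proposal. Numbering is p3's. Each `T_…` is a closed Prop and
# `T_…_holds` its proof. Tree coupling `β` (`SU(2)`: Wilson `β_W = 2β`; `SU(N)`: 't Hooft `b/N`). All HYPOTHESIS-FREE.
HONEST FRAMING: lattice strong-coupling statements about the infinite-volume free energy density `freeEnergyDensity d ρ β`;
`C¹`/`C²` in the coupling (not analyticity); one-state windows; nothing about the continuum or Clay.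
-/


open MeasureTheory ProbabilityTheory Set
open scoped NNReal ContDiff
open Literature.MathematicalPhysics.QuantumLattice
open Literature.MathematicalPhysics.QuantumFieldTheory hiding ZdEdge Site


open Summit.Ventures.YMGap.PressureRegularity

/-- C-PRESS (C¹, `SU(2)`, `d = 4`): the infinite-volume free energy density `f = freeEnergyDensity 4 ρ_{SU(2)}` (tree
coupling `β`; Wilson `β_W = 2β`) is differentiable at EVERY `0 < β < 9/50` with the thermodynamic identity
`f'(β) = -Σ_{i<j} (2 - ⟨Re tr U_{p_ij}⟩_ν)` for EVERY DLR state `ν ∈ 𝒢(β)` (the state is unique there). -/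
def T56a_SU2PressureC1 : Prop :=
  ∀ β ∈ Ioo (0 : ℝ) (9 / 50), ∀ ν : Measure (LGConfig 4 (Matrix.specialUnitaryGroup (Fin 2) ℂ)),
    ν ∈ ymGibbsMeasures (d := 4) (fundamentalRep (Fin 2)) β →
      HasDerivAt (freeEnergyDensity 4 (fundamentalRep (Fin 2)))
        (-∑ q : {q : Fin 4 × Fin 4 // q.1 < q.2},
          ((2 : ℝ) - ∫ U, plaquetteObs (fundamentalRep (Fin 2)) 0 q.1.1 q.1.2 U ∂ν)) β

/-- Proof of `T56a_SU2PressureC1`. -/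
theorem T56a_SU2PressureC1_holds : T56a_SU2PressureC1 :=
  fun _ hβ _ hν => su2_hasDerivAt_freeEnergyDensity_of_mem hβ hν

/-- C-PRESS (closed window incl. `β = 0⁺`, `SU(2)`, `d = 4`): along ANY DLR selection `μ` on `[0, 9/50]`, `f` has the
one-sided/two-sided derivative `-Σ_{i<j} (2 - ⟨Re tr U_{p_ij}⟩_{μ β})` WITHIN `[0, 9/50]` at every `β ∈ [0, 9/50]`, and this
derivative is continuous on `[0, 9/50]` (`f ∈ C¹[0, 9/50]`). -/
def T56b_SU2PressureClosedWindow : Prop :=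
  ∀ μ : ℝ → Measure (LGConfig 4 (Matrix.specialUnitaryGroup (Fin 2) ℂ)),
    (∀ β ∈ Icc (0 : ℝ) (9 / 50), μ β ∈ ymGibbsMeasures (d := 4) (fundamentalRep (Fin 2)) β) →
    (∀ β ∈ Icc (0 : ℝ) (9 / 50),
      HasDerivWithinAt (freeEnergyDensity 4 (fundamentalRep (Fin 2)))
        (-∑ q : {q : Fin 4 × Fin 4 // q.1 < q.2},
          ((2 : ℝ) - ∫ U, plaquetteObs (fundamentalRep (Fin 2)) 0 q.1.1 q.1.2 U ∂(μ β))) (Icc (0 : ℝ) (9 / 50)) β) ∧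
    ContinuousOn (fun β => -∑ q : {q : Fin 4 × Fin 4 // q.1 < q.2},
        ((2 : ℝ) - ∫ U, plaquetteObs (fundamentalRep (Fin 2)) 0 q.1.1 q.1.2 U ∂(μ β))) (Icc (0 : ℝ) (9 / 50))

/-- Proof of `T56b_SU2PressureClosedWindow`. -/
theorem T56b_SU2PressureClosedWindow_holds : T56b_SU2PressureClosedWindow :=
  fun _ hμ => ⟨fun _ hβ => su2_hasDerivWithinAt_freeEnergyDensity hμ hβ, su2_continuousOn_energyDensity hμ⟩

/-- C-PRESS (C², `SU(2)`, `d = 4`): `f ∈ C²(0, 9/50)` (`ContDiffOn ℝ 2`), and at EVERY `0 < β < 9/50`, for EVERY DLR state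
`ν ∈ 𝒢(β)`, `f'` has derivative the plaquette susceptibility `Σ_{i<j} 4 Σ_q Cov_ν(W_{p_ij}, W_q)` (`W = ½ Re tr`), which is
`≥ 0` — no first- or second-order transition in the strong-coupling window, as a theorem about the thermodynamic potential. -/
def T56c_SU2PressureC2 : Prop :=
  ContDiffOn ℝ 2 (freeEnergyDensity 4 (fundamentalRep (Fin 2))) (Ioo (0 : ℝ) (9 / 50)) ∧
  ∀ β ∈ Ioo (0 : ℝ) (9 / 50), ∀ ν : Measure (LGConfig 4 (Matrix.specialUnitaryGroup (Fin 2) ℂ)),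
    ν ∈ ymGibbsMeasures (d := 4) (fundamentalRep (Fin 2)) β →
      HasDerivAt (deriv (freeEnergyDensity 4 (fundamentalRep (Fin 2))))
        (∑ q : {q : Fin 4 × Fin 4 // q.1 < q.2}, 4 * ∑' r : ZdPlaquette 4,
          cov[zdPlaquetteObs (fundamentalRep (Fin 2)) 0 q.1.1 q.1.2,
            zdPlaquetteObs (fundamentalRep (Fin 2)) r.1 r.2.1.1 r.2.1.2; ν]) β ∧
      0 ≤ ∑ q : {q : Fin 4 × Fin 4 // q.1 < q.2}, 4 * ∑' r : ZdPlaquette 4,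
          cov[zdPlaquetteObs (fundamentalRep (Fin 2)) 0 q.1.1 q.1.2,
            zdPlaquetteObs (fundamentalRep (Fin 2)) r.1 r.2.1.1 r.2.1.2; ν]

/-- Proof of `T56c_SU2PressureC2`. -/
theorem T56c_SU2PressureC2_holds : T56c_SU2PressureC2 :=
  ⟨su2_contDiffOn_two_freeEnergyDensity,
    fun _ hβ _ hν => ⟨su2_hasDerivAt_deriv_freeEnergyDensity_of_mem hβ hν, su2_susceptibility_nonneg hβ hν⟩⟩

/-- C-PRESS (every `SU(N)`, `N ≥ 2`, `d = 4`, hypothesis-free): `f_N = freeEnergyDensity 4 ρ_{SU(N)}` is `C²` on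
`(0, N·9/308)` ('t Hooft `b/N < 9/308`), with `f_N'(b) = -Σ_{i<j} (N - ⟨Re tr U_{p_ij}⟩_ν)` and
`f_N''(b) = Σ_{i<j} N² Σ_q Cov_ν(W_{p_ij}, W_q)` (`W = (1/N) Re tr`) for every DLR state `ν ∈ 𝒢(b)`. -/
def T56d_SUNPressureC2 : Prop :=
  ∀ N : ℕ, 2 ≤ N →
    ContDiffOn ℝ 2 (freeEnergyDensity 4 (fundamentalRep (Fin N))) (Ioo (0 : ℝ) ((N : ℝ) * (9 / 308))) ∧
    ∀ b ∈ Ioo (0 : ℝ) ((N : ℝ) * (9 / 308)), ∀ ν : Measure (LGConfig 4 (Matrix.specialUnitaryGroup (Fin N) ℂ)),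
      ν ∈ ymGibbsMeasures (d := 4) (fundamentalRep (Fin N)) b →
        HasDerivAt (freeEnergyDensity 4 (fundamentalRep (Fin N)))
            (-∑ q : {q : Fin 4 × Fin 4 // q.1 < q.2},
              ((N : ℝ) - ∫ U, plaquetteObs (fundamentalRep (Fin N)) 0 q.1.1 q.1.2 U ∂ν)) b ∧
          HasDerivAt (deriv (freeEnergyDensity 4 (fundamentalRep (Fin N))))
            (∑ q : {q : Fin 4 × Fin 4 // q.1 < q.2}, (N : ℝ) ^ 2 * ∑' r : ZdPlaquette 4,
              cov[zdPlaquetteObs (fundamentalRep (Fin N)) 0 q.1.1 q.1.2,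
                zdPlaquetteObs (fundamentalRep (Fin N)) r.1 r.2.1.1 r.2.1.2; ν]) b

/-- Proof of `T56d_SUNPressureC2`. -/
theorem T56d_SUNPressureC2_holds : T56d_SUNPressureC2 :=
  fun _ hN => ⟨contDiffOn_two_freeEnergyDensity_SU_thooft hN,
    fun _ hb _ hν => hasDerivAt_freeEnergyDensity_SU_thooft_of_mem hN hb hν⟩

/-- C-PRESS (every `SU(N)`, `N ≥ 2`, EVERY dimension `d ≥ 2`, hypothesis-free): the free energy density of `SU(N)` lattice
Yang–Mills on `ℤ^d` is `C²` on `(0, N/(12(d-1)))`, with `f'(b) = -Σ_{i<j} (N - ⟨Re tr U_{p_ij}⟩_ν)` and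
`f''(b) = Σ_{i<j} N² Σ_q Cov_ν(W_{p_ij}, W_q)` for every DLR state `ν ∈ 𝒢(b)`. -/
def T56e_SUNDimPressureC2 : Prop :=
  ∀ d N : ℕ, 2 ≤ d → 2 ≤ N →
    ContDiffOn ℝ 2 (freeEnergyDensity d (fundamentalRep (Fin N))) (Ioo (0 : ℝ) ((N : ℝ) / (12 * ((d : ℝ) - 1)))) ∧
    ∀ b ∈ Ioo (0 : ℝ) ((N : ℝ) / (12 * ((d : ℝ) - 1))), ∀ ν : Measure (LGConfig d (Matrix.specialUnitaryGroup (Fin N) ℂ)),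
      ν ∈ ymGibbsMeasures (d := d) (fundamentalRep (Fin N)) b →
        HasDerivAt (freeEnergyDensity d (fundamentalRep (Fin N)))
            (-∑ q : {q : Fin d × Fin d // q.1 < q.2},
              ((N : ℝ) - ∫ U, plaquetteObs (fundamentalRep (Fin N)) 0 q.1.1 q.1.2 U ∂ν)) b ∧
          HasDerivAt (deriv (freeEnergyDensity d (fundamentalRep (Fin N))))
            (∑ q : {q : Fin d × Fin d // q.1 < q.2}, (N : ℝ) ^ 2 * ∑' r : ZdPlaquette d,
              cov[zdPlaquetteObs (fundamentalRep (Fin N)) 0 q.1.1 q.1.2,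
                zdPlaquetteObs (fundamentalRep (Fin N)) r.1 r.2.1.1 r.2.1.2; ν]) b

/-- Proof of `T56e_SUNDimPressureC2`. -/
theorem T56e_SUNDimPressureC2_holds : T56e_SUNDimPressureC2 :=
  fun _ _ hd hN => ⟨contDiffOn_two_freeEnergyDensity_dim_thooft hd hN,
    fun _ hb _ hν => hasDerivAt_freeEnergyDensity_dim_thooft_of_mem hd hN hb hν⟩

/-- Block A holds. -/
theorem v1x_ds1g9_blockA_holds :
    T56a_SU2PressureC1 ∧ T56b_SU2PressureClosedWindow ∧ T56c_SU2PressureC2 ∧ T56d_SUNPressureC2 ∧ T56e_SUNDimPressureC2 :=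
  ⟨T56a_SU2PressureC1_holds, T56b_SU2PressureClosedWindow_holds, T56c_SU2PressureC2_holds, T56d_SUNPressureC2_holds,
    T56e_SUNDimPressureC2_holds⟩



end V22_ds1_PressureA

/-! ### OWNER FILE `ds/ds3/lean/g12/texts/V1XConjunctsDS3g12D.lean` (sha16 e73730e0ac1422ed) — section `V22_ds3_PartD` -/
section V22_ds3_PartD

/-!
Statement v1.x candidate conjuncts from ds-3's gen-12 files, PART D (TEXT for the p3 seat; checkable once `BoundaryDecaySummable.lean`
(p367437, ACCEPTED b4e066eb7a38) and `BoundaryDecaySummableSU2.lean` (p367775) are IN THE TREE; NOT proposed by ds-3). Y2 ROBUST-BALL,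
TIER 2: SUMMABLE (infinite-range) members forget their boundary condition at the Dobrushin weight rate `t` (Föllmer (2.8)/(2.10) with
Cor. (2.14), usable set Λ, summable rows). HONEST LABEL: Dobrushin-comparison lower bound on the rate; lattice strong coupling; nothing continuum.
-/

open MeasureTheory Filter Topology
open scoped NNReal
open Literature.Probability.LatticeModels hiding configShift configShift_apply
open Literature.MathematicalPhysics.QuantumLattice (fundamentalRep ZdEdge LGConfig)
open Literature.MathematicalPhysics.QuantumFieldTheory (IsLipschitzCylinder)
open Summit.Ventures.YMGap
open Summit.Ventures.YMGap.RobustBall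

/-- **T57a_SU2SummableBoundaryRate — `SU(2)`, every `d ≥ 1`, HYPOTHESIS-FREE, UNIFORMLY ON THE TIER-2 BALL `MemBallZdS a Λ_t t`** (Wilson
units, 't Hooft `β_W/4`; `t ≥ 0`): if `2(d−1)|β_W| e^{a} e^{t} + e^{a/2} √(2/3) Λ_t < 1` then for EVERY member `W`, EVERY DLR state `μ`,
EVERY finite volume `Λ`, EVERY boundary field `η`, every Lipschitz cylinder `F` (constant `K`, links `Δ`) at base-point depth `≥ D` inside `Λ`:
`|∫ F dγ^{W,S}_Λ(· | η) − ∫ F dμ| ≤ 2√2 · K · #Δ · e^{−t D}` (`RobustBall.su2_abs_boundaryS_sub_integral_le_of_memBallZdS`). -/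
def T57a_SU2SummableBoundaryRate : Prop :=
  ∀ (d : ℕ), 1 ≤ d → ∀ (βW a Λt t : ℝ) (W : Potential (ZdEdge d) (Matrix.specialUnitaryGroup (Fin 2) ℂ)),
    MemBallZdS a Λt t W → 0 ≤ t →
    2 * ((d : ℝ) - 1) * |βW| * (Real.exp a * Real.exp t) + Real.exp (a / 2) * Real.sqrt (2 / 3) * Λt < 1 →
    ∀ μ ∈ perturbedGibbsMeasuresS (d := d) (fundamentalRep (Fin 2)) ((2 : ℕ) * (βW / 4)) W,
    ∀ (Λ : Finset (ZdEdge d)) (η : LGConfig d (Matrix.specialUnitaryGroup (Fin 2) ℂ))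
      (F : LGConfig d (Matrix.specialUnitaryGroup (Fin 2) ℂ) → ℝ) (Δ : Finset (ZdEdge d)) (K : ℝ≥0),
      IsLipschitzCylinder (fundamentalRep (Fin 2)) F Δ K → ∀ D : ℝ, (∀ y ∈ Δ, ∀ z, z ∉ Λ → D ≤ ‖y.1 - z.1‖) →
        |(∫ U, F U ∂(perturbedYMS (d := d) (fundamentalRep (Fin 2)) ((2 : ℕ) * (βW / 4)) W Λ η)) - ∫ U, F U ∂μ| ≤
          2 * Real.sqrt 2 * K * Δ.card * Real.exp (-(t * D))

/-- T57a_SU2SummableBoundaryRate holds. -/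
theorem T57a_SU2SummableBoundaryRate_holds : T57a_SU2SummableBoundaryRate :=
  fun _ hd _ _ _ _ _ hmem ht hρ _ hμ Λ η _ _ _ hF _ hD =>
    su2_abs_boundaryS_sub_integral_le_of_memBallZdS hd hmem ht hρ hμ Λ η hF hD

/-- **T57b_SUNSummableBoundaryRate — every `N ≥ 2`, every `d ≥ 1`, HYPOTHESIS-FREE (Bakry–Émery pair), on `MemBallZdS a Λ_t t`**: with
`b = 2(d−1)|β| < 1/2` and `6(d−1)|β| e^{a} e^{t}/(1/2 − b) + e^{a/2} Λ_t/√(N(1/2 − b)) < 1`: for every member, DLR state, volume, boundary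
field and Lipschitz cylinder at depth `≥ D`: `|∫ F dγ^{W,S}_Λ(·|η) − ∫ F dμ| ≤ 2√N · K · #Δ · e^{−t D}`
(`RobustBall.suN_abs_boundaryS_sub_integral_le_bakryEmery`). -/
def T57b_SUNSummableBoundaryRate : Prop :=
  ∀ (d N : ℕ), 1 ≤ d → 2 ≤ N → ∀ (β a Λt t : ℝ) (W : Potential (ZdEdge d) (Matrix.specialUnitaryGroup (Fin N) ℂ)),
    |β| * (2 * ((d : ℝ) - 1)) < 1 / 2 → MemBallZdS a Λt t W → 0 ≤ t →
    6 * ((d : ℝ) - 1) * |β| * (Real.exp a * Real.exp t) / (1 / 2 - |β| * (2 * ((d : ℝ) - 1))) +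
      Real.exp (a / 2) * Λt / Real.sqrt ((N : ℝ) * (1 / 2 - |β| * (2 * ((d : ℝ) - 1)))) < 1 →
    ∀ μ ∈ perturbedGibbsMeasuresS (d := d) (fundamentalRep (Fin N)) (N * β) W,
    ∀ (Λ : Finset (ZdEdge d)) (η : LGConfig d (Matrix.specialUnitaryGroup (Fin N) ℂ))
      (F : LGConfig d (Matrix.specialUnitaryGroup (Fin N) ℂ) → ℝ) (Δ : Finset (ZdEdge d)) (K : ℝ≥0),
      IsLipschitzCylinder (fundamentalRep (Fin N)) F Δ K → ∀ D : ℝ, (∀ y ∈ Δ, ∀ z, z ∉ Λ → D ≤ ‖y.1 - z.1‖) →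
        |(∫ U, F U ∂(perturbedYMS (d := d) (fundamentalRep (Fin N)) (N * β) W Λ η)) - ∫ U, F U ∂μ| ≤
          2 * Real.sqrt N * K * Δ.card * Real.exp (-(t * D))

/-- T57b_SUNSummableBoundaryRate holds. -/
theorem T57b_SUNSummableBoundaryRate_holds : T57b_SUNSummableBoundaryRate :=
  fun _ _ hd hN _ _ _ _ _ hb hmem ht hρ _ hμ Λ η _ _ _ hF _ hD =>
    suN_abs_boundaryS_sub_integral_le_bakryEmery hd hN hb hmem ht hρ hμ Λ η hF hD

end V22_ds3_PartD

/-! ### DEFAULT GROUPING (p2): one consolidating conjunction per owner file — `G_<tag> := T_a ∧ T_b ∧ …` + `_holds`.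
The lead composes V22 by theme; p3 renames `G_<tag> ↦ T<k>_<Name>` (via --map) or regroups at will; these are additions, not owner bytes. -/
section V22_groups_A

/-- Default group for section `V22_rbp2_FreeEnergyLaw`: the conjunction of its 4 owner texts. -/
def T55_FreeEnergyStrongCouplingLaw : Prop :=
  T55a_SU2FreeEnergyStrongCouplingLawDim4 ∧ T55b_SUNFreeEnergyStrongCouplingLaw ∧ T55c_SU2InternalEnergyLawDim4 ∧ T55d_SU2FreeEnergySandwichDim4

/-- `T55_FreeEnergyStrongCouplingLaw` holds (componentwise by the owners' `_holds`). -/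
theorem T55_FreeEnergyStrongCouplingLaw_holds : T55_FreeEnergyStrongCouplingLaw :=
  ⟨T55a_SU2FreeEnergyStrongCouplingLawDim4_holds, T55b_SUNFreeEnergyStrongCouplingLaw_holds, T55c_SU2InternalEnergyLawDim4_holds, T55d_SU2FreeEnergySandwichDim4_holds⟩

/-- Default group for section `V22_ds1_PressureA`: the conjunction of its 5 owner texts. -/
def T56_PressureSmoothStrongCoupling : Prop :=
  T56a_SU2PressureC1 ∧ T56b_SU2PressureClosedWindow ∧ T56c_SU2PressureC2 ∧ T56d_SUNPressureC2 ∧ T56e_SUNDimPressureC2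

/-- `T56_PressureSmoothStrongCoupling` holds (componentwise by the owners' `_holds`). -/
theorem T56_PressureSmoothStrongCoupling_holds : T56_PressureSmoothStrongCoupling :=
  ⟨T56a_SU2PressureC1_holds, T56b_SU2PressureClosedWindow_holds, T56c_SU2PressureC2_holds, T56d_SUNPressureC2_holds, T56e_SUNDimPressureC2_holds⟩

/-- Default group for section `V22_ds3_PartD`: the conjunction of its 2 owner texts. -/
def T57_SummableBoundaryRateBall : Prop :=
  T57a_SU2SummableBoundaryRate ∧ T57b_SUNSummableBoundaryRate

/-- `T57_SummableBoundaryRateBall` holds (componentwise by the owners' `_holds`). -/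
theorem T57_SummableBoundaryRateBall_holds : T57_SummableBoundaryRateBall :=
  ⟨T57a_SU2SummableBoundaryRate_holds, T57b_SUNSummableBoundaryRate_holds⟩

end V22_groups_A

end Summit.Ventures.YMGap

end
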